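import Summits.ValiantsHypothesis.ValiantsHypothesis.Theorems.SuccinctLiftResidueTwo

/-!
# SuccinctLift — the `2`-NON-UNIT cut of WALL-D (`AlgDescentLog3`, item `stmt-ValiantsHypothesis-23721`)
# and its VP-internal leaf: the determinant over `𝔽̄₂` (support / kernel certificate, lens 2, g31)

WALL-D of the route `SuccinctLift` is, by the tree theorem
`SuccinctLiftCharTwo.algDescentLog3_iff_perHardLog3`, the statement `A = PerHardLog3`: the permanent has no
`∃ c ∀ n` family of `(n^c+c)`-wire circuits over `ℂ` of product-depth `Δ₁ n = ⌊log₂⌊log₂⌊log₂ n⌋⌋⌋ + 1`.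
Generation g28 (`SuccinctLiftResidueTwo`) decided the sub-region of `A` consisting of the constant rings
WITH AN `𝔽₂`-POINT (`R →+* 𝔽₂`); generations g29/g30 showed that every "generic / low-degree number field /
integer-advice" reformulation of the rest is EQUIVALENT to the `ℚ`-level statement.  This file cuts the wall
along a different coordinate — `2`-ADIC INTEGRALITY of the constants — which strictly enlarges the decided /
reducible region and isolates the residue:

* §1 the dial point `PerEasyOver R Δ` over an ARBITRARY commutative ring of constants `R` (it is `PerEasyComplex`,
  `PerEasyMod p`, … at `R = ℂ, 𝔽_p, …`, by `Iff.rfl`) and its monotonicity along ring maps;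
* §2 **`𝔽̄_p` is a universal test ring for the `p`-non-unit constant rings** (`perEasyOver_algClosure_of_not_isUnit`,
  `not_perEasyOver_algClosure_iff`): if `per` is hard at budget `Δ` over `AlgebraicClosure (ZMod p)` then it is hard
  at the same budget over EVERY commutative ring in which `p` is not a unit — and conversely (take `R = 𝔽̄_p`).
  Proof: the constants of a circuit generate a finitely generated `ℤ`-algebra `A ⊆ R` in which `p` is not a
  unit; a maximal ideal `M ∋ p` has finite residue field (`finite_quotient_of_isMaximal`, Zariski's lemma over the
  Jacobson ring `ℤ`) of characteristic `p`, which embeds into `𝔽̄_p` (`IsAlgClosed.lift`); map the circuit.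
  (g28's transfer needed an `𝔽₂`-POINT of `R`; a `2`-non-unit ring need only have an `𝔽_{2^f}`-point — the
  "inert notch" `ℤ[ω]`, `ℤ[ζ_7]`, … of g28 §4 — and `𝔽̄₂` absorbs every `f` at once.)
* §3 **the cut**: `A ⟺ NonUnitHardAt 2 Δ₁ ∧ DenominatorLiftAt 2 Δ₁` (`perHard_iff_nonUnitHard_and_lift`,
  `algDescentLog3_iff_twoNonUnit_split`), where
  `NonUnitHardAt p Δ` := per is hard at `Δ` over every subring `R ⊆ ℂ` with `p ∉ Rˣ` (NECESSARY for `VH`,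
  `nonUnitHardAt_of_vh`; it contains ALL algebraic-integer constants — `not_isUnit_natCast_of_forall_isIntegral`,
  `nonUnitHardAt_algebraicIntegers` — in particular every survivor named by g30: cyclotomic composita, entangled
  algebraic-integer tuples, the quasi-polynomial-degree band of integers), and
  `DenominatorLiftAt p Δ` := a polynomial-wire depth-`Δ` family over `ℂ` can be replaced by one whose constants
  generate a ring with `p ∉ Rˣ` ("clearing the `p`-power denominators"; NECESSARY, `denominatorLiftAt_of_vh`).
  HONESTY (`denominatorLiftAt_iff_residual`): `DenominatorLiftAt p Δ ⟺ (NonUnitHardAt p Δ → A_Δ)` — the lift half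
  is the BARE RESIDUAL of the integrality half (same verdict as the census instrument `collapseTo_iff_residual`
  for lens 4's `B`); its only known mechanism is the `½`-notch of `SuccinctLiftResidueTwo` §4 (`ℤ[1/2]`, V22).
* §4 **the leaf** (`nonUnitHardAt_of_not_perEasyOver_algClosure`, and at `p = 2` via `per = det` in
  characteristic `2`, `perEasyOver_iff_detEasyOver_of_charTwo`):
  `¬ DetEasyOver (AlgebraicClosure (ZMod 2)) Δ₁ → NonUnitHardAt 2 Δ₁` — "the DETERMINANT has no polynomial-wire
  circuits of product-depth `log log log n + 1` over `𝔽̄₂`" is a VP-INTERNAL statement (no `VNP`, no permanent)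
  that implies the whole `2`-integral half of WALL-D.  Its floor is DECIDED: over the prime field `𝔽₂` itself
  (`not_detEasyOver_zmod_two_log3`, from g28's `not_perEasyMod_two_log3`: Razborov–Smolensky), hence over every
  ring with an `𝔽₂`-point (`nonUnitHardAt_two_log3_of_F2point`); open from `𝔽₄` upward (the inert notch; the
  Boolean shadow of an `𝔽₄`-circuit is `ACC⁰[6]`).  `p = 2` is the unique prime at which the integral half of
  `A` is dominated by a VP-internal statement (for odd `p`, `per ≠ det` over `𝔽̄_p`).

Reading for the record: this is a RE-TAGGING of the open core of WALL-D, not progress on `VP ≠ VNP`: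
`NonUnitHardAt 2 Δ₁` is NEC · WEAKER-than-`A` (presumably strictly) · OPEN, with a VP-internal sufficient
condition whose `𝔽₂`-floor is decided; `DenominatorLiftAt 2 Δ₁` is NEC · BARE RESIDUAL.  No item, no route
edit; support for `stmt-ValiantsHypothesis-23721` only.

References: [Burgisser2000, §4.1, Thm. 4.13] (constants dial, reduction of constants to finite fields);
[Razborov1987] and Smolensky 1987 (the `𝔽₂` floor, through `SuccinctLiftResidueTwo`); [Valiant1979] (`per = det`
in characteristic `2`); [LimayeSrinivasanTavenas2025] / Forbes (CCC 2024) for the print status of constant-depth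
lower bounds over small fields (context only: the `𝔽̄₂` leaf at slope `1` is open in print).
-/

namespace Summit.ValiantsHypothesis.ValiantsHypothesis.Theorems.SuccinctLiftTwoNonUnit

open Literature.Computability.AlgebraicComplexity MvPolynomial
  Summit.ValiantsHypothesis.ValiantsHypothesis.Theses.SuccinctLift
  Summit.ValiantsHypothesis.ValiantsHypothesis.Theorems.SuccinctLift
  Summit.ValiantsHypothesis.ValiantsHypothesis.Theorems.SuccinctLiftCharTwo
  Summit.ValiantsHypothesis.ValiantsHypothesis.Theorems.SuccinctLiftResidueTwo

/-! ### §1 The dial point over an arbitrary commutative ring of constants -/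

/-- Dial point `D_R` at budget `Δ`: the permanent has an `∃ c ∀ n` family of `(n^c+c)`-wire circuits of
product-depth `≤ Δ n` with constants in the commutative ring `R`.  At `R = ℂ`, `𝔽_p`, `ℚ` this is
`PerEasyComplex Δ`, `PerEasyMod p Δ`, `PerEasyRat Δ` (by `Iff.rfl`). [cite: Burgisser2000, §4.1] -/
def PerEasyOver (R : Type) [CommRing R] (Δ : ℕ → ℕ) : Prop :=
  ∃ c : ℕ, ∀ n : ℕ, ∃ C : ArithCircuit R (Fin n × Fin n),
    C.Computes (perPoly (Fin n) R) ∧ C.productDepth ≤ Δ n ∧ C.edgeSize ≤ n ^ c + c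

/-- The same dial point for the DETERMINANT (a `VP`-internal statement). [cite: Burgisser2000, §2.1] -/
def DetEasyOver (R : Type) [CommRing R] (Δ : ℕ → ℕ) : Prop :=
  ∃ c : ℕ, ∀ n : ℕ, ∃ C : ArithCircuit R (Fin n × Fin n),
    C.Computes (detPoly (Fin n) R) ∧ C.productDepth ≤ Δ n ∧ C.edgeSize ≤ n ^ c + c

/-- `D_ℂ` is the route's `PerEasyComplex`. [cite: Burgisser2000, §4.1] -/
theorem perEasyOver_complex_iff (Δ : ℕ → ℕ) : PerEasyOver ℂ Δ ↔ PerEasyComplex Δ := Iff.rfl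

/-- `D_{𝔽_p}` is the route's `PerEasyMod p`. [cite: Burgisser2000, §4.1] -/
theorem perEasyOver_zmod_iff (p : ℕ) (Δ : ℕ → ℕ) : PerEasyOver (ZMod p) Δ ↔ PerEasyMod p Δ := Iff.rfl

/-- WALL-D's target `A = PerHardLog3` is `¬ D_ℂ` at `Δ₁`. [cite: Burgisser2000, §4.1] -/
theorem perHardLog3_iff_not_perEasyOver :
    PerHardLog3 ↔ ¬ PerEasyOver ℂ (fun n => Nat.log 2 (Nat.log 2 (Nat.log 2 n)) + 1) := Iff.rfl

/-- In characteristic `2` the permanent IS the determinant, so `D_R` for `per` and for `det` coincide.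
[cite: Valiant1979] -/
theorem perEasyOver_iff_detEasyOver_of_charTwo (R : Type) [CommRing R] [CharP R 2] (Δ : ℕ → ℕ) :
    PerEasyOver R Δ ↔ DetEasyOver R Δ := by
  simp only [PerEasyOver, DetEasyOver, perPoly_eq_detPoly_of_charP_two]

/-- **Monotonicity UP the dial along any ring map**: a family over `R` maps coefficient-wise to a family over
`S` with the same skeleton. [cite: Burgisser2000, §4.1] -/
theorem perEasyOver_of_ringHom {R S : Type} [CommRing R] [CommRing S] (φ : R →+* S) (Δ : ℕ → ℕ)
    (h : PerEasyOver R Δ) : PerEasyOver S Δ := by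
  obtain ⟨c, hc⟩ := h
  refine ⟨c, fun n => ?_⟩
  obtain ⟨C, hC, hd, hs⟩ := hc n
  obtain ⟨D, hD, hdD, hsD⟩ := exists_circuit_of_ringHom' φ C hC
  exact ⟨D, hD, hdD ▸ hd, hsD ▸ hs⟩

/-- Contrapositive: hardness over `S` pulls back along `φ : R →+* S`. [cite: Burgisser2000, §4.1] -/
theorem not_perEasyOver_of_ringHom {R S : Type} [CommRing R] [CommRing S] (φ : R →+* S) (Δ : ℕ → ℕ)
    (h : ¬ PerEasyOver S Δ) : ¬ PerEasyOver R Δ :=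
  fun hR => h (perEasyOver_of_ringHom φ Δ hR)

/-! ### §2 `𝔽̄_p` is a universal test ring for the `p`-non-unit constant rings -/

/-- **Skeleton-exact reduction of a `p`-non-unit constant ring to `𝔽̄_p`.**  If `p` is prime and NOT a unit of
the commutative ring `R`, a circuit over `R` computing (the image of) an integer polynomial `f` yields a circuit
over `AlgebraicClosure (ZMod p)` computing `f`, with the same product-depth, number of wires and size: restrict
the constants to the finitely generated ring `A = ℤ[consts C] ⊆ R` (`p ∉ Aˣ`), pass to the finite residue field
`A ⧸ M` of a maximal ideal `M ∋ p` (characteristic `p`), and embed it into `𝔽̄_p`. [cite: Burgisser2000, §4.1] -/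
theorem exists_algClosureConstants_of_not_isUnit {p : ℕ} [hp : Fact p.Prime] {R : Type} [CommRing R]
    (hR : ¬ IsUnit ((p : ℕ) : R)) {σ : Type} (C : ArithCircuit R σ) (f : MvPolynomial σ ℤ)
    (hC : C.Computes (MvPolynomial.map (Int.castRingHom R) f)) :
    ∃ C' : ArithCircuit (AlgebraicClosure (ZMod p)) σ,
      C'.Computes (MvPolynomial.map (Int.castRingHom (AlgebraicClosure (ZMod p))) f) ∧
      C'.productDepth = C.productDepth ∧ C'.edgeSize = C.edgeSize ∧ C'.size = C.size := by
  classical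
  -- Step 1: restrict the constants of `C` to `A = ℤ[consts C] ⊆ R`.
  let S : Finset R := C.consts.toFinset
  let A : Subalgebra ℤ R := Algebra.adjoin ℤ (S : Set R)
  haveI : Algebra.FiniteType ℤ A :=
    (Subalgebra.fg_iff_finiteType A).mp (Subalgebra.fg_adjoin_finset S)
  let ρ : R → A := fun z => if h : z ∈ (S : Set R) then ⟨z, Algebra.subset_adjoin h⟩ else 0
  let ι : A →+* R := (A.val : A →ₐ[ℤ] R).toRingHom
  have hι : Function.Injective ι := Subtype.val_injective
  let CA : ArithCircuit A σ := C.mapConsts ρ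
  have hfix : ∀ c ∈ C.consts, ι (ρ c) = c := by
    intro c hc
    have hcS : c ∈ (S : Set R) := Finset.mem_coe.mpr (List.mem_toFinset.mpr hc)
    simp only [ρ, dif_pos hcS]
    rfl
  have hCA : CA.map ι = C := ArithCircuit.map_mapConsts_eq_self ρ ι C hfix
  have hevA : CA.eval = MvPolynomial.map (Int.castRingHom A) f := by
    refine MvPolynomial.map_injective ι hι ?_
    rw [← ArithCircuit.eval_map_apply, hCA, MvPolynomial.map_map,
      Subsingleton.elim (ι.comp (Int.castRingHom A)) (Int.castRingHom R)]
    exact hC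
  -- Step 2: `p` is not a unit of `A`; a maximal ideal `M ∋ p` has finite residue field of characteristic `p`.
  have hpA : ¬ IsUnit ((p : ℕ) : A) := fun h => hR (by simpa using h.map ι)
  obtain ⟨M, hMmax, hpM⟩ := Ideal.exists_le_maximal (Ideal.span {((p : ℕ) : A)})
    (fun htop => hpA (Ideal.span_singleton_eq_top.mp htop))
  haveI : Finite (A ⧸ M) := Literature.GroupTheory.ArithmeticGroups.finite_quotient_of_isMaximal M
  letI : Field (A ⧸ M) := Ideal.Quotient.field M
  have hp0 : ((p : ℕ) : A ⧸ M) = 0 := by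
    rw [← map_natCast (Ideal.Quotient.mk M), Ideal.Quotient.eq_zero_iff_mem]
    exact hpM (Ideal.mem_span_singleton_self _)
  haveI : CharP (A ⧸ M) p := ringChar.of_eq (CharP.ringChar_of_prime_eq_zero hp.out hp0)
  letI : Algebra (ZMod p) (A ⧸ M) := ZMod.algebra _ p
  haveI : Module.IsTorsionFree (ZMod p) (A ⧸ M) := DivisionSemiring.to_moduleIsTorsionFree
  haveI : Module.IsTorsionFree (ZMod p) (AlgebraicClosure (ZMod p)) :=
    DivisionSemiring.to_moduleIsTorsionFree
  haveI : Algebra.IsAlgebraic (ZMod p) (A ⧸ M) := Algebra.IsAlgebraic.of_finite (ZMod p) _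
  -- Step 3: embed the finite field `A ⧸ M` into `𝔽̄_p` and map the circuit.
  let ψ : A ⧸ M →+* AlgebraicClosure (ZMod p) :=
    (IsAlgClosed.lift (R := ZMod p) (M := AlgebraicClosure (ZMod p)) (S := A ⧸ M)).toRingHom
  let θ : A →+* AlgebraicClosure (ZMod p) := ψ.comp (Ideal.Quotient.mk M)
  refine ⟨CA.map θ, ?_, ?_, ?_, ?_⟩
  · show (CA.map θ).eval = _
    rw [ArithCircuit.eval_map_apply, hevA, MvPolynomial.map_map,
      Subsingleton.elim (θ.comp (Int.castRingHom A)) (Int.castRingHom (AlgebraicClosure (ZMod p)))]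
  · rw [ArithCircuit.productDepth_mapCoeff]
    conv_rhs => rw [← hCA]
    exact (ArithCircuit.productDepth_mapCoeff ι CA).symm
  · rw [ArithCircuit.edgeSize_mapCoeff]
    conv_rhs => rw [← hCA]
    exact (ArithCircuit.edgeSize_mapCoeff ι CA).symm
  · rw [ArithCircuit.size_map]
    conv_rhs => rw [← hCA]
    exact (ArithCircuit.size_map ι CA).symm

/-- **`𝔽̄_p`-easiness follows from easiness over ANY `p`-non-unit ring**, at the same budget.
[cite: Burgisser2000, §4.1] -/
theorem perEasyOver_algClosure_of_not_isUnit {p : ℕ} [Fact p.Prime] {R : Type} [CommRing R]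
    (hR : ¬ IsUnit ((p : ℕ) : R)) (Δ : ℕ → ℕ) (h : PerEasyOver R Δ) :
    PerEasyOver (AlgebraicClosure (ZMod p)) Δ := by
  obtain ⟨c, hc⟩ := h
  refine ⟨c, fun n => ?_⟩
  obtain ⟨C, hC, hd, hs⟩ := hc n
  obtain ⟨C', hC', hd', hs', -⟩ :=
    exists_algClosureConstants_of_not_isUnit hR C (perPoly (Fin n) ℤ) (by rwa [map_perPoly])
  exact ⟨C', by rwa [map_perPoly] at hC', hd' ▸ hd, hs' ▸ hs⟩

/-- **Hardness over `𝔽̄_p` transfers to every `p`-non-unit constant ring**, at the same budget.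
[cite: Burgisser2000, §4.1] -/
theorem not_perEasyOver_of_not_isUnit {p : ℕ} [Fact p.Prime] (Δ : ℕ → ℕ)
    (h : ¬ PerEasyOver (AlgebraicClosure (ZMod p)) Δ) {R : Type} [CommRing R]
    (hR : ¬ IsUnit ((p : ℕ) : R)) : ¬ PerEasyOver R Δ :=
  fun hR' => h (perEasyOver_algClosure_of_not_isUnit hR Δ hR')

/-- `p` is not a unit of `𝔽̄_p` (it is `0`). [folklore] -/
theorem not_isUnit_natCast_algClosure (p : ℕ) [Fact p.Prime] :
    ¬ IsUnit ((p : ℕ) : AlgebraicClosure (ZMod p)) := by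
  rw [CharP.cast_eq_zero (AlgebraicClosure (ZMod p)) p]
  exact not_isUnit_zero

/-- **Universal test ring**: `per` is hard at budget `Δ` over `𝔽̄_p` IFF it is hard at budget `Δ` over every
commutative ring (in `Type`) in which `p` is not a unit. [cite: Burgisser2000, §4.1] -/
theorem not_perEasyOver_algClosure_iff {p : ℕ} [Fact p.Prime] (Δ : ℕ → ℕ) :
    ¬ PerEasyOver (AlgebraicClosure (ZMod p)) Δ ↔
      ∀ (R : Type) [CommRing R], ¬ IsUnit ((p : ℕ) : R) → ¬ PerEasyOver R Δ :=
  ⟨fun h _ _ hR => not_perEasyOver_of_not_isUnit Δ h hR,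
    fun h => h _ (not_isUnit_natCast_algClosure p)⟩

/-! ### §3 The cut of WALL-D: `p`-integral half and `p`-denominator lift -/

/-- **`D_int(p, Δ)`** — the `p`-INTEGRAL half of `A_Δ`: the permanent is hard at budget `Δ` over every subring
`R ⊆ ℂ` in which `p` is not a unit (equivalently: whose every finite set of elements is integral at some common
place above `p`).  Necessary for `VH`. [cite: Burgisser2000, §4.1] -/
def NonUnitHardAt (p : ℕ) (Δ : ℕ → ℕ) : Prop :=
  ∀ R : Subring ℂ, ¬ IsUnit ((p : ℕ) : R) → ¬ PerEasyOver R Δ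

/-- **`D_den(p, Δ)`** — the `p`-DENOMINATOR LIFT: a polynomial-wire depth-`Δ` family for the permanent over `ℂ`
can be replaced by one (same exponent budget shape) all of whose constants lie in a subring `R ⊆ ℂ` with
`p ∉ Rˣ`.  Necessary for `VH` (vacuously). [cite: Burgisser2000, §4.1] -/
def DenominatorLiftAt (p : ℕ) (Δ : ℕ → ℕ) : Prop :=
  PerEasyOver ℂ Δ → ∃ R : Subring ℂ, ¬ IsUnit ((p : ℕ) : R) ∧ PerEasyOver R Δ

/-- **THE CUT (exact)**: `A_Δ ⟺ D_int(p, Δ) ∧ D_den(p, Δ)` for every `p`. [cite: Burgisser2000, §4.1] -/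
theorem perHard_iff_nonUnitHard_and_lift (p : ℕ) (Δ : ℕ → ℕ) :
    ¬ PerEasyOver ℂ Δ ↔ NonUnitHardAt p Δ ∧ DenominatorLiftAt p Δ := by
  constructor
  · intro h
    exact ⟨fun R _ hR => h (perEasyOver_of_ringHom R.subtype Δ hR), fun hC => absurd hC h⟩
  · rintro ⟨hint, hden⟩ hC
    obtain ⟨R, hR, hE⟩ := hden hC
    exact hint R hR hE

/-- `D_int` is a consequence of `A` (monotonicity along `R ⊆ ℂ`). [cite: Burgisser2000, §4.1] -/
theorem nonUnitHardAt_of_perHard (p : ℕ) (Δ : ℕ → ℕ) (h : ¬ PerEasyOver ℂ Δ) : NonUnitHardAt p Δ :=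
  ((perHard_iff_nonUnitHard_and_lift p Δ).mp h).1

/-- **HONESTY — `D_den` is the BARE RESIDUAL of `D_int`**: `D_den ⟺ (D_int → A)`.  The lift half carries no
content independent of the target beyond the integrality half; its only known mechanism is the `½`-notch
(`SuccinctLiftResidueTwo` §4). [folklore] -/
theorem denominatorLiftAt_iff_residual (p : ℕ) (Δ : ℕ → ℕ) :
    DenominatorLiftAt p Δ ↔ (NonUnitHardAt p Δ → ¬ PerEasyOver ℂ Δ) := by
  constructor
  · intro hden hint hC
    obtain ⟨R, hR, hE⟩ := hden hC
    exact hint R hR hE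
  · intro h hC
    by_contra hne
    push Not at hne
    exact h (fun R hR => hne R hR) hC

/-- **Necessity of `A_Δ`** at every depth (binarisation, `SuccinctLift.not_perEasyComplex_of_vh`).
[cite: Burgisser2000TCS, §2] -/
theorem not_perEasyOver_complex_of_vh (Δ : ℕ → ℕ) (h : _root_.ValiantsHypothesis) : ¬ PerEasyOver ℂ Δ :=
  not_perEasyComplex_of_vh Δ h

/-- **`D_int` is NECESSARY for `VH`.** [cite: Burgisser2000TCS, §2] -/
theorem nonUnitHardAt_of_vh (p : ℕ) (Δ : ℕ → ℕ) (h : _root_.ValiantsHypothesis) : NonUnitHardAt p Δ :=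
  nonUnitHardAt_of_perHard p Δ (not_perEasyOver_complex_of_vh Δ h)

/-- **`D_den` is NECESSARY for `VH`** (vacuously: under `VH` there is no family to lift). [cite: Burgisser2000TCS, §2] -/
theorem denominatorLiftAt_of_vh (p : ℕ) (Δ : ℕ → ℕ) (h : _root_.ValiantsHypothesis) :
    DenominatorLiftAt p Δ :=
  ((perHard_iff_nonUnitHard_and_lift p Δ).mp (not_perEasyOver_complex_of_vh Δ h)).2

/-! ### §4 The leaf: hardness over `𝔽̄_p`; at `p = 2`, hardness of the DETERMINANT over `𝔽̄₂` -/

/-- **LEAF ⟹ `D_int`**: if the permanent is hard at budget `Δ` over `𝔽̄_p`, then it is hard at budget `Δ` over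
every subring of `ℂ` in which `p` is not a unit. [cite: Burgisser2000, §4.1] -/
theorem nonUnitHardAt_of_not_perEasyOver_algClosure {p : ℕ} [Fact p.Prime] (Δ : ℕ → ℕ)
    (h : ¬ PerEasyOver (AlgebraicClosure (ZMod p)) Δ) : NonUnitHardAt p Δ :=
  fun _ hR => not_perEasyOver_of_not_isUnit Δ h hR

/-- **VP-INTERNAL LEAF at `p = 2`**: if the DETERMINANT has no `∃ c ∀ n` family of `(n^c+c)`-wire circuits of
product-depth `≤ Δ n` over `𝔽̄₂`, then the permanent is hard at budget `Δ` over every `2`-non-unit subring of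
`ℂ` — the whole `2`-integral half of `A_Δ`. [cite: Valiant1979] -/
theorem nonUnitHardAt_two_of_not_detEasyOver_algClosure (Δ : ℕ → ℕ)
    (h : ¬ DetEasyOver (AlgebraicClosure (ZMod 2)) Δ) : NonUnitHardAt 2 Δ :=
  haveI : Fact (Nat.Prime 2) := ⟨Nat.prime_two⟩
  nonUnitHardAt_of_not_perEasyOver_algClosure Δ
    (fun hP => h ((perEasyOver_iff_detEasyOver_of_charTwo _ Δ).mp hP))

/-- **A ring with an `𝔽₂`-point is a `2`-non-unit ring** (so g28's decided region lies inside `D_int`'s domain).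
[folklore] -/
theorem not_isUnit_two_of_ringHom_zmod_two {R : Type} [CommRing R] (φ : R →+* ZMod 2) :
    ¬ IsUnit ((2 : ℕ) : R) := fun h =>
  (isEmpty_ringHom_zmod_two_of_isUnit_two (by exact_mod_cast h)).false φ

/-- **Algebraic integers are `m`-non-unit for every `m > 1`**: in a subring of `ℂ` consisting of algebraic
integers no natural number `m > 1` is a unit (`1/m` is not an algebraic integer: `ℤ` is integrally closed).
Hence `D_int(p, Δ)` covers every family with ALGEBRAIC-INTEGER constants — cyclotomic integers `ℤ[ζ_N]` of any
conductor, composita, entangled tuples. [folklore] -/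
theorem not_isUnit_natCast_of_forall_isIntegral (R : Subring ℂ) (hR : ∀ x ∈ R, IsIntegral ℤ x) {m : ℕ}
    (hm : 1 < m) : ¬ IsUnit ((m : ℕ) : R) := by
  rintro ⟨u, hu⟩
  set v : R := ↑u⁻¹ with hv
  have hmul : ((m : ℕ) : ℂ) * (v : ℂ) = 1 := by
    have h1 : (u : R) * v = 1 := by rw [hv, Units.mul_inv]
    have h2 := congrArg (fun x : R => (x : ℂ)) h1
    simpa [hu] using h2
  have hm0 : ((m : ℕ) : ℂ) ≠ 0 := by exact_mod_cast (by omega : m ≠ 0)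
  have hvC : (v : ℂ) = algebraMap ℚ ℂ ((m : ℚ)⁻¹) := by
    rw [map_inv₀, map_natCast]
    exact ((mul_eq_one_iff_inv_eq₀ hm0).mp hmul).symm
  have hint : IsIntegral ℤ (v : ℂ) := hR _ v.2
  rw [hvC, isIntegral_algebraMap_iff (algebraMap ℚ ℂ).injective] at hint
  obtain ⟨y, hy⟩ := (IsIntegrallyClosed.isIntegral_iff (R := ℤ) (K := ℚ)).mp hint
  have hyq : ((m : ℕ) : ℚ) * (y : ℚ) = 1 := by
    have : (algebraMap ℤ ℚ) y = (y : ℚ) := rfl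
    rw [← this, hy]
    exact mul_inv_cancel₀ (by exact_mod_cast (by omega : m ≠ 0))
  have hyz : (m : ℤ) * y = 1 := by exact_mod_cast hyq
  have := Int.eq_one_of_mul_eq_one_right (by omega) hyz
  omega

/-- **`D_int` covers the ring of ALL algebraic integers**: under the `𝔽̄_p` leaf, the permanent is hard at
budget `Δ` with constants ranging over all algebraic integers in `ℂ` at once. [cite: Burgisser2000, §4.1] -/
theorem nonUnitHardAt_algebraicIntegers {p : ℕ} [hp : Fact p.Prime] (Δ : ℕ → ℕ) (h : NonUnitHardAt p Δ) :
    ¬ PerEasyOver (integralClosure ℤ ℂ).toSubring Δ :=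
  h _ (not_isUnit_natCast_of_forall_isIntegral _
    (fun _ hx => (mem_integralClosure_iff ℤ ℂ).mp (Subalgebra.mem_toSubring.mp hx)) hp.out.one_lt)

/-- **The algebraic integers lie in the OPEN (inert) part of `D_int(2, ·)`**: the ring of all algebraic
integers in `ℂ` has NO `𝔽₂`-point — it contains a primitive cube root of unity, whose image would be a root of
`X² + X + 1` in `𝔽₂` — although `2` is not a unit in it (`not_isUnit_natCast_of_forall_isIntegral`).  So it is
outside g28's decided region (`SuccinctLiftResidueTwo` §3) and inside the reach of the `𝔽̄₂` leaf. [folklore] -/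
theorem isEmpty_ringHom_algebraicIntegers_zmod_two :
    IsEmpty ((integralClosure ℤ ℂ).toSubring →+* ZMod 2) := by
  refine ⟨fun φ => ?_⟩
  have key : ∀ μ : ℂ, IsPrimitiveRoot μ 3 → False := by
    intro μ hμ
    have hint : IsIntegral ℤ μ := hμ.isIntegral (by norm_num)
    have hmem : μ ∈ (integralClosure ℤ ℂ).toSubring :=
      Subalgebra.mem_toSubring.mpr ((mem_integralClosure_iff ℤ ℂ).mpr hint)
    have hμ1 : μ ≠ 1 := hμ.ne_one (by norm_num)
    have hpoly : μ ^ 2 + μ + 1 = 0 := by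
      have h3 : μ ^ 3 = 1 := hμ.pow_eq_one
      have h : (μ - 1) * (μ ^ 2 + μ + 1) = 0 := by linear_combination h3
      exact (mul_eq_zero.mp h).resolve_left (sub_ne_zero.mpr hμ1)
    let z : (integralClosure ℤ ℂ).toSubring := ⟨μ, hmem⟩
    have hz : z ^ 2 + z + 1 = 0 := Subtype.ext (by simp [z, hpoly])
    have hφ := congrArg φ hz
    rw [map_add, map_add, map_pow, map_one, map_zero] at hφ
    exact zmod_two_sq_add_self_add_one_ne_zero (φ z) hφ
  exact key _ (Complex.isPrimitiveRoot_exp 3 (by norm_num))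

/-! ### §5 Calibration at the route budget `Δ₁ = ⌊log₂⌊log₂⌊log₂ n⌋⌋⌋ + 1`, `p = 2` -/

/-- **The floor of the leaf is DECIDED**: the determinant (= permanent) has no polynomial-wire circuits of
product-depth `Δ₁` over the prime field `𝔽₂` (g28, Razborov–Smolensky through the Boolean bridge).
[cite: Razborov1987] -/
theorem not_detEasyOver_zmod_two_log3 :
    ¬ DetEasyOver (ZMod 2) (fun n => Nat.log 2 (Nat.log 2 (Nat.log 2 n)) + 1) := fun h =>
  not_perEasyMod_two_log3 ((perEasyOver_iff_detEasyOver_of_charTwo (ZMod 2) _).mpr h)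

/-- The floor, permanent form, over any ring with an `𝔽₂`-point. [cite: Razborov1987] -/
theorem not_perEasyOver_log3_of_ringHom_zmod_two {R : Type} [CommRing R] (φ : R →+* ZMod 2) :
    ¬ PerEasyOver R (fun n => Nat.log 2 (Nat.log 2 (Nat.log 2 n)) + 1) :=
  not_perEasyOver_of_ringHom φ _ not_perEasyMod_two_log3

/-- **The DECIDED sub-region of `D_int(2, Δ₁)`**: every subring of `ℂ` with an `𝔽₂`-point (these are
`2`-non-unit rings, `not_isUnit_two_of_ringHom_zmod_two`).  What remains OPEN in `D_int(2, Δ₁)` is the inert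
notch: `2`-non-unit subrings all of whose residue fields above `2` are `𝔽_{2^f}`, `f ≥ 2` (`ℤ[ω]`, `ℤ[ζ_7]`, …,
`SuccinctLiftResidueTwo` §4) — exactly what the `𝔽̄₂` leaf would absorb. [cite: Razborov1987] -/
theorem nonUnitHardAt_two_log3_of_F2point (R : Subring ℂ) (φ : R →+* ZMod 2) :
    ¬ PerEasyOver R (fun n => Nat.log 2 (Nat.log 2 (Nat.log 2 n)) + 1) :=
  not_perEasyOver_log3_of_ringHom_zmod_two φ

/-- **WALL-D, cut form**: `AlgDescentLog3 ⟺ D_int(2, Δ₁) ∧ D_den(2, Δ₁)`. [cite: Burgisser2000, §4.1] -/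
theorem algDescentLog3_iff_twoNonUnit_split :
    AlgDescentLog3 ↔
      NonUnitHardAt 2 (fun n => Nat.log 2 (Nat.log 2 (Nat.log 2 n)) + 1) ∧
        DenominatorLiftAt 2 (fun n => Nat.log 2 (Nat.log 2 (Nat.log 2 n)) + 1) :=
  algDescentLog3_iff_perHardLog3.trans (perHard_iff_nonUnitHard_and_lift 2 _)

/-- **WALL-D from the VP-internal leaf and the denominator lift**: if the determinant has no polynomial-wire
circuits of product-depth `log₂ log₂ log₂ n + 1` over `𝔽̄₂`, and complex families for the permanent at that
depth can be cleared of `2`-power denominators, then `AlgDescentLog3` holds. [cite: Valiant1979] -/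
theorem algDescentLog3_of_detHard_algClosure_two
    (hleaf : ¬ DetEasyOver (AlgebraicClosure (ZMod 2)) (fun n => Nat.log 2 (Nat.log 2 (Nat.log 2 n)) + 1))
    (hden : DenominatorLiftAt 2 (fun n => Nat.log 2 (Nat.log 2 (Nat.log 2 n)) + 1)) : AlgDescentLog3 :=
  algDescentLog3_iff_twoNonUnit_split.mpr ⟨nonUnitHardAt_two_of_not_detEasyOver_algClosure _ hleaf, hden⟩

/-- **Both halves hold under `VH`** at the route budget (consistency / necessity of the cut).
[cite: Burgisser2000TCS, §2] -/
theorem twoNonUnit_split_of_vh (h : _root_.ValiantsHypothesis) :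
    NonUnitHardAt 2 (fun n => Nat.log 2 (Nat.log 2 (Nat.log 2 n)) + 1) ∧
      DenominatorLiftAt 2 (fun n => Nat.log 2 (Nat.log 2 (Nat.log 2 n)) + 1) :=
  ⟨nonUnitHardAt_of_vh 2 _ h, denominatorLiftAt_of_vh 2 _ h⟩

end Summit.ValiantsHypothesis.ValiantsHypothesis.Theorems.SuccinctLiftTwoNonUnit
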